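import Literature.NumberTheory.Sieve.PrimePowersInProgressions
import Mathlib.NumberTheory.ArithmeticFunction.Misc
import Mathlib.Analysis.SpecialFunctions.Pow.Real
import HarnessLib

/-!
# Goldston–Pintz–Yıldırım, *Primes in tuples I*, Lemma 2: sums of generalized divisor functions

Trunk: NumberTheory / Sieve. The second of the "Two Lemmas" of §5 of D. A. Goldston, J. Pintz,
C. Y. Yıldırım, *Primes in tuples. I*, Ann. of Math. 170 (2009) (arXiv:math/0508185, p. 11), the
elementary divisor-sum estimates used to control the error terms in the proofs of Propositions 1
and 2 (e.g. the `O(R²(3 log R)^{3k+M})` of (7.2)/(7.6)). Everything here is PROVED.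

With `d_m(q) = m^{ω(q)}` (real `m`; (5.8)) and `∑♭` a sum over squarefree `q`:

* `Literature.NumberTheory.Sieve.GPY.sumDGenDiv_le`, `Literature.NumberTheory.Sieve.GPY.ceil_add_log_pow_le` — (5.11): for real `m > 0`, `x ≥ 1`,
  `D'(x, m) := ∑♭_{q ≤ x} d_m(q)/q ≤ (⌈m⌉ + log x)^{⌈m⌉} ≤ (m + 1 + log x)^{m+1}`;
* `Literature.NumberTheory.Sieve.GPY.sumDGen_le`, `Literature.NumberTheory.Sieve.GPY.sumDGen_le_rpow` — (5.12):
  `D*(x, m) := ∑♭_{q ≤ x} d_m(q) ≤ x (⌈m⌉ + log x)^{⌈m⌉} ≤ x (m + 1 + log x)^{m+1}`;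
* `Literature.NumberTheory.Sieve.GPY.sumDGenDiv_rpow_le` — (5.13): for `ν ≥ max(c' log(K+1), 1)`, `x ≥ 1`, `K ≥ 1`,
  `∑♭_{q ≤ x} (d_{3K}(q))^{1+1/ν}/q ≤ (C'K + log x)^{C'K}` with `C' = 9e^{1/c'} + 1`;
* `Literature.NumberTheory.Sieve.GPY.dGen_mul`, `Literature.NumberTheory.Sieve.GPY.dGen_rpow` — (5.9).

Proof of (5.11): for an integer `m = n` the bound `D'(x, n) ≤ (∑_{e ≤ x} 1/e)^n ≤ (1 + log x)^n`
is the tree's `Literature.NumberTheory.Sieve.sum_pow_card_primeFactors_div_le` (`PrimePowersInProgressions.lean`, the same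
induction `(n+1)^{ω(q)} ≤ ∑_{d ∣ q} n^{ω(d)}` as GPY's bookkeeping by the smallest factor, over all
`q ≤ x`) restricted to squarefree `q`, with the harmonic bound `Literature.NumberTheory.Sieve.sum_Icc_one_div_le_one_add_log`;
real `m` reduces to `⌈m⌉` by monotonicity. Survivors of this file: the GPY objects `dGen`,
`squarefreeLE`, `sumDGenDiv`, `sumDGen` and the statements (5.9), (5.11)–(5.13) as printed
(`sumDGenDiv_le`, `ceil_add_log_pow_le`, `sumDGen_le`, `sumDGen_le_rpow`, `sumDGenDiv_rpow_le`,
`dGen_mul`, `dGen_rpow`).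

## References

* D. A. Goldston, J. Pintz, C. Y. Yıldırım, *Primes in tuples. I*, Ann. of Math. (2) 170 (2009),
  819–862, doi:10.4007/annals.2009.170.819 = arXiv:math/0508185, §5 Lemma 2, (5.8)–(5.13), p. 11.
  [cite: GoldstonPintzYildirim2009]
-/

noncomputable section

open Finset Real
open scoped ArithmeticFunction.omega

namespace Literature.NumberTheory.Sieve.GPY

/-- GPY (5.8): the generalized divisor function `d_m(q) = m^{ω(q)}` for a real parameter `m`,
`ω(q)` the number of distinct prime factors. On squarefree `q` and for a positive integer `m = k`
this is the usual `d_k(q)`, in the tree `Literature.divisorCountK k q` (`τ_k = ζ^k`,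
`Literature.divisorCountK_apply_of_squarefree : τ_k(q) = k^{ω(q)}`, `AsymptoticSieveForPrimesInputs.lean`,
not imported here: `dGen (k : ℝ) q = (divisorCountK k q : ℝ)` for squarefree `q` by that lemma and
`Nat.cast_pow`). [cite: GoldstonPintzYildirim2009, eq. 5.8] -/
def dGen (m : ℝ) (q : ℕ) : ℝ := m ^ ω q

/-- The range `∑♭_{q ≤ x}` of GPY §5: the squarefree integers `1 ≤ q ≤ x`.
[cite: GoldstonPintzYildirim2009, Lemma 2] -/
def squarefreeLE (x : ℝ) : Finset ℕ := (Icc 1 ⌊x⌋₊).filter Squarefree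

/-- GPY Lemma 2, (5.11): `D'(x, m) = ∑♭_{q ≤ x} d_m(q) / q`.
[cite: GoldstonPintzYildirim2009, Lemma 2 eq. 5.11] -/
def sumDGenDiv (x m : ℝ) : ℝ := ∑ q ∈ squarefreeLE x, dGen m q / q

/-- GPY Lemma 2, (5.12): `D*(x, m) = ∑♭_{q ≤ x} d_m(q)`.
[cite: GoldstonPintzYildirim2009, Lemma 2 eq. 5.12] -/
def sumDGen (x m : ℝ) : ℝ := ∑ q ∈ squarefreeLE x, dGen m q

/-- Membership in `squarefreeLE x`. [folklore] -/
theorem mem_squarefreeLE {x : ℝ} {q : ℕ} :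
    q ∈ squarefreeLE x ↔ (1 ≤ q ∧ q ≤ ⌊x⌋₊) ∧ Squarefree q := by
  simp [squarefreeLE]

/-- `∑_{1 ≤ e ≤ x} 1/e ≤ 1 + log x` for real `x ≥ 1`, from the tree's integer form
`Literature.NumberTheory.Sieve.sum_Icc_one_div_le_one_add_log` (`PrimePowersInProgressions.lean`). [folklore] -/
theorem sum_Icc_one_div_le {x : ℝ} (hx : 1 ≤ x) :
    ∑ e ∈ Icc 1 ⌊x⌋₊, (1 : ℝ) / e ≤ 1 + Real.log x := by
  have h := Literature.NumberTheory.Sieve.sum_Icc_one_div_le_one_add_log ⌊x⌋₊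
  have hN' : (0 : ℝ) < ⌊x⌋₊ := by exact_mod_cast Nat.floor_pos.2 hx
  have hlog : Real.log ⌊x⌋₊ ≤ Real.log x := Real.log_le_log hN' (Nat.floor_le (by linarith))
  linarith

/-- `D'(x, n) ≤ (∑_{e ≤ x} 1/e)^n` for integers `n ≥ 1`: GPY's induction on `m` (p. 11) is the
tree's `Literature.NumberTheory.Sieve.sum_pow_card_primeFactors_div_le` (`PrimePowersInProgressions.lean`:
`∑_{q ≤ Q} n^{#primeFactors q}/q ≤ H_Q^n` over ALL `q ≤ Q`, proved there by the convolution step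
`(n+1)^{ω(q)} ≤ ∑_{d ∣ q} n^{ω(d)}`), restricted to the squarefree `q` (nonnegative terms).
[cite: GoldstonPintzYildirim2009, Lemma 2 proof] -/
theorem sumDGenDiv_nat_le {n : ℕ} (hn : 1 ≤ n) (x : ℝ) :
    sumDGenDiv x n ≤ (∑ e ∈ Icc 1 ⌊x⌋₊, (1 : ℝ) / e) ^ n := by
  have hω : ∀ q : ℕ, ω q = q.primeFactors.card := fun q => by
    rw [ArithmeticFunction.cardDistinctFactors_apply, Nat.primeFactors, List.card_toFinset]
  calc sumDGenDiv x n = ∑ q ∈ squarefreeLE x, (n : ℝ) ^ q.primeFactors.card / q := by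
        unfold sumDGenDiv dGen
        simp only [hω]
    _ ≤ ∑ q ∈ Icc 1 ⌊x⌋₊, (n : ℝ) ^ q.primeFactors.card / q :=
        Finset.sum_le_sum_of_subset_of_nonneg (Finset.filter_subset _ _)
          fun q _ _ => by positivity
    _ ≤ (∑ e ∈ Icc 1 ⌊x⌋₊, (1 : ℝ) / e) ^ n := Literature.NumberTheory.Sieve.sum_pow_card_primeFactors_div_le hn ⌊x⌋₊

/-- `d_m(q)` is monotonically increasing in `m ≥ 0` (GPY p. 11, "clearly").
[cite: GoldstonPintzYildirim2009, eq. 5.9] -/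
theorem dGen_mono {m m' : ℝ} (hm : 0 ≤ m) (h : m ≤ m') (q : ℕ) : dGen m q ≤ dGen m' q :=
  pow_le_pow_left₀ hm h _

/-- `D'(x, m)` is monotone in `m ≥ 0`, whence `D'(x, m) ≤ D'(x, ⌈m⌉)` (GPY p. 11, last line of the
proof of (5.11)). [cite: GoldstonPintzYildirim2009, Lemma 2 proof] -/
theorem sumDGenDiv_mono {m m' : ℝ} (hm : 0 ≤ m) (h : m ≤ m') (x : ℝ) :
    sumDGenDiv x m ≤ sumDGenDiv x m' :=
  Finset.sum_le_sum fun q _ => div_le_div_of_nonneg_right (dGen_mono hm h q) (Nat.cast_nonneg q)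

/-- **GPY Lemma 2, (5.11)**, first inequality: for real `m > 0` and `x ≥ 1`,
`D'(x, m) = ∑♭_{q ≤ x} d_m(q)/q ≤ (⌈m⌉ + log x)^{⌈m⌉}` (proved with the slightly better
`(1 + log x)^{⌈m⌉}` on the way). [cite: GoldstonPintzYildirim2009, Lemma 2 eq. 5.11] -/
theorem sumDGenDiv_le {m x : ℝ} (hm : 0 < m) (hx : 1 ≤ x) :
    sumDGenDiv x m ≤ ((⌈m⌉₊ : ℝ) + Real.log x) ^ ⌈m⌉₊ := by
  have hc1 : 1 ≤ ⌈m⌉₊ := Nat.ceil_pos.2 hm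
  have hmc : m ≤ ⌈m⌉₊ := Nat.le_ceil m
  have hlog : 0 ≤ Real.log x := Real.log_nonneg hx
  have hH : 0 ≤ ∑ e ∈ Icc 1 ⌊x⌋₊, (1 : ℝ) / e := Finset.sum_nonneg fun e _ => by positivity
  have hc1' : (1 : ℝ) ≤ ⌈m⌉₊ := by exact_mod_cast hc1
  calc sumDGenDiv x m ≤ sumDGenDiv x (⌈m⌉₊ : ℕ) := sumDGenDiv_mono hm.le hmc x
    _ ≤ (∑ e ∈ Icc 1 ⌊x⌋₊, (1 : ℝ) / e) ^ ⌈m⌉₊ := sumDGenDiv_nat_le hc1 x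
    _ ≤ (1 + Real.log x) ^ ⌈m⌉₊ := pow_le_pow_left₀ hH (sum_Icc_one_div_le hx) _
    _ ≤ ((⌈m⌉₊ : ℝ) + Real.log x) ^ ⌈m⌉₊ :=
        pow_le_pow_left₀ (by positivity) (by linarith) _

/-- **GPY Lemma 2, (5.11)**, second inequality: `(⌈m⌉ + log x)^{⌈m⌉} ≤ (m + 1 + log x)^{m+1}` for
`m > 0`, `x ≥ 1` (real exponent on the right).
[cite: GoldstonPintzYildirim2009, Lemma 2 eq. 5.11] -/
theorem ceil_add_log_pow_le {m x : ℝ} (hm : 0 < m) (hx : 1 ≤ x) :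
    ((⌈m⌉₊ : ℝ) + Real.log x) ^ ⌈m⌉₊ ≤ (m + 1 + Real.log x) ^ (m + 1) := by
  have hlog : 0 ≤ Real.log x := Real.log_nonneg hx
  have hc : (⌈m⌉₊ : ℝ) ≤ m + 1 := (Nat.ceil_lt_add_one hm.le).le
  have hbase : 1 ≤ m + 1 + Real.log x := by linarith
  calc ((⌈m⌉₊ : ℝ) + Real.log x) ^ ⌈m⌉₊ ≤ (m + 1 + Real.log x) ^ ⌈m⌉₊ :=
        pow_le_pow_left₀ (by positivity) (by linarith) _
    _ = (m + 1 + Real.log x) ^ ((⌈m⌉₊ : ℕ) : ℝ) := (Real.rpow_natCast _ _).symm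
    _ ≤ (m + 1 + Real.log x) ^ (m + 1) := Real.rpow_le_rpow_of_exponent_le hbase hc

/-- **GPY Lemma 2, (5.12)**: for real `m > 0` and `x ≥ 1`,
`D*(x, m) = ∑♭_{q ≤ x} d_m(q) ≤ x (⌈m⌉ + log x)^{⌈m⌉}` (since `D*(x, m) ≤ x D'(x, m)`).
[cite: GoldstonPintzYildirim2009, Lemma 2 eq. 5.12] -/
theorem sumDGen_le {m x : ℝ} (hm : 0 < m) (hx : 1 ≤ x) :
    sumDGen x m ≤ x * ((⌈m⌉₊ : ℝ) + Real.log x) ^ ⌈m⌉₊ := by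
  have h1 : sumDGen x m ≤ x * sumDGenDiv x m := by
    unfold sumDGen sumDGenDiv
    rw [Finset.mul_sum]
    refine Finset.sum_le_sum fun q hq => ?_
    obtain ⟨⟨hq1, hqx⟩, -⟩ := mem_squarefreeLE.1 hq
    have hq0 : (0 : ℝ) < q := by exact_mod_cast hq1
    have hqx' : (q : ℝ) ≤ x := le_trans (by exact_mod_cast hqx) (Nat.floor_le (by linarith))
    have hd : 0 ≤ dGen m q := pow_nonneg hm.le _
    rw [mul_div_assoc', le_div_iff₀ hq0]
    nlinarith
  exact h1.trans (mul_le_mul_of_nonneg_left (sumDGenDiv_le hm hx) (by linarith))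

/-- **GPY Lemma 2, (5.12)**, second inequality: `D*(x, m) ≤ x (m + 1 + log x)^{m+1}`.
[cite: GoldstonPintzYildirim2009, Lemma 2 eq. 5.12] -/
theorem sumDGen_le_rpow {m x : ℝ} (hm : 0 < m) (hx : 1 ≤ x) :
    sumDGen x m ≤ x * (m + 1 + Real.log x) ^ (m + 1) :=
  (sumDGen_le hm hx).trans (mul_le_mul_of_nonneg_left (ceil_add_log_pow_le hm hx) (by linarith))

/-- GPY (5.9), second identity: `(d_m(q))^y = d_{m^y}(q)` for real `y` and `m ≥ 0`.
[cite: GoldstonPintzYildirim2009, eq. 5.9] -/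
theorem dGen_rpow {m : ℝ} (hm : 0 ≤ m) (y : ℝ) (q : ℕ) : dGen m q ^ y = dGen (m ^ y) q := by
  unfold dGen
  rw [← Real.rpow_natCast, ← Real.rpow_mul hm, mul_comm, Real.rpow_mul hm, Real.rpow_natCast]

/-- GPY (5.9), first identity: `d_{m₁}(q) d_{m₂}(q) = d_{m₁ m₂}(q)`.
[cite: GoldstonPintzYildirim2009, eq. 5.9] -/
theorem dGen_mul (m₁ m₂ : ℝ) (q : ℕ) : dGen m₁ q * dGen m₂ q = dGen (m₁ * m₂) q := by
  unfold dGen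
  rw [mul_pow]

/-- **GPY Lemma 2, (5.13)**: for `ν ≥ max(c' log(K + 1), 1)` there is a constant `C'` depending only
on `c' > 0` (here `C' = 9 e^{1/c'} + 1`, as in the printed proof: `(3K)^{1+1/ν} ≤ 9 e^{1/c'} K`)
such that for `x ≥ 1` and `K ≥ 1`, `∑♭_{q ≤ x} (d_{3K}(q))^{1 + 1/ν} / q ≤ (C' K + log x)^{C' K}`.
[cite: GoldstonPintzYildirim2009, Lemma 2 eq. 5.13] -/
theorem sumDGenDiv_rpow_le {c' : ℝ} (hc' : 0 < c') :
    ∃ C' : ℝ, 0 < C' ∧ ∀ (ν K x : ℝ), 1 ≤ K → 1 ≤ x → 1 ≤ ν → c' * Real.log (K + 1) ≤ ν →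
      ∑ q ∈ squarefreeLE x, dGen (3 * K) q ^ (1 + 1 / ν) / q ≤
        ((C' * K) + Real.log x) ^ (C' * K) := by
  refine ⟨9 * Real.exp (1 / c') + 1, by positivity, fun ν K x hK hx hν1 hνc => ?_⟩
  set r := (3 * K) ^ (1 + 1 / ν) with hr
  have h3K : (0 : ℝ) ≤ 3 * K := by linarith
  have hsum : ∑ q ∈ squarefreeLE x, dGen (3 * K) q ^ (1 + 1 / ν) / q = sumDGenDiv x r := by
    unfold sumDGenDiv
    refine Finset.sum_congr rfl fun q _ => ?_
    rw [dGen_rpow h3K]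
  rw [hsum]
  have hν0 : 0 < ν := by linarith
  have hrK : r ≤ 9 * Real.exp (1 / c') * K := by
    have e1 : r = 3 * K * (3 * K) ^ (1 / ν) := by
      rw [hr, Real.rpow_add (by linarith), Real.rpow_one]
    have e2 : (3 * K) ^ (1 / ν) = (3 : ℝ) ^ (1 / ν) * K ^ (1 / ν) :=
      Real.mul_rpow (by norm_num) (by linarith)
    have e3 : (3 : ℝ) ^ (1 / ν) ≤ 3 := by
      calc (3 : ℝ) ^ (1 / ν) ≤ 3 ^ (1 : ℝ) :=
            Real.rpow_le_rpow_of_exponent_le (by norm_num) (by rw [div_le_one hν0]; exact hν1)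
        _ = 3 := Real.rpow_one 3
    have e4 : K ^ (1 / ν) ≤ Real.exp (1 / c') := by
      rw [Real.rpow_def_of_pos (by linarith), Real.exp_le_exp]
      have hlogK : 0 ≤ Real.log K := Real.log_nonneg hK
      have hlogK1 : Real.log K ≤ Real.log (K + 1) := Real.log_le_log (by linarith) (by linarith)
      rw [mul_one_div, div_le_div_iff₀ hν0 hc']
      nlinarith [mul_le_mul_of_nonneg_left hlogK1 hc'.le]
    calc r = 3 * K * ((3 : ℝ) ^ (1 / ν) * K ^ (1 / ν)) := by rw [e1, e2]
      _ ≤ 3 * K * (3 * Real.exp (1 / c')) := by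
          apply mul_le_mul_of_nonneg_left _ h3K
          exact mul_le_mul e3 e4 (by positivity) (by norm_num)
      _ = 9 * Real.exp (1 / c') * K := by ring
  have hr0 : 0 < r := by rw [hr]; positivity
  have hlog : 0 ≤ Real.log x := Real.log_nonneg hx
  have hexp1 : 1 ≤ Real.exp (1 / c') := Real.one_le_exp (by positivity)
  have hbase1 : 1 ≤ (9 * Real.exp (1 / c') + 1) * K + Real.log x := by nlinarith
  calc sumDGenDiv x r ≤ ((⌈r⌉₊ : ℝ) + Real.log x) ^ ⌈r⌉₊ := sumDGenDiv_le hr0 hx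
    _ ≤ (r + 1 + Real.log x) ^ (r + 1) := ceil_add_log_pow_le hr0 hx
    _ ≤ ((9 * Real.exp (1 / c') + 1) * K + Real.log x) ^ (r + 1) := by
        apply Real.rpow_le_rpow (by linarith) _ (by linarith)
        nlinarith
    _ ≤ ((9 * Real.exp (1 / c') + 1) * K + Real.log x) ^ ((9 * Real.exp (1 / c') + 1) * K) := by
        apply Real.rpow_le_rpow_of_exponent_le hbase1
        nlinarith

end Literature.NumberTheory.Sieve.GPY
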